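import Summits.HodgeConjecture.HodgeConjecture.Theorems.Ring2ClassTargets
import Literature.AlgebraicGeometry.HodgeTheory.DivisorClassesHardLefschetz
import HarnessLib

/-!
# Ring 2 · class-targets axis (typer1) — the LOW-DEGREE CLASS: abelian varieties of dimension ≤ 7 whose
# rational (2,2)- and (3,3)-classes are divisorial satisfy the Hodge conjecture, UNCONDITIONALLY (no `HC_CM`,
# no named fact): the kernel form of the atlas's 25 "`B = D`" rows of dimensions 6 and 7

HONEST FRAMING (page 1, verbatim): **research route conditional on HC_CM; not a corollary; Q11.4-sentence-2
already refuted in dim ≥ 3.** THIS file is the `HC_CM`-ABSENT corner of the class axis: every theorem below is a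
THEOREM of the tree with NO binder (Lefschetz (1,1) + hard Lefschetz for the divisor ring + van Geemen §2.4, all
landed: lit gen 11 `DivisorClassesHardLefschetz` p196453 and `hodgeConjectureFor_of_isDivisorGenerated`). What is
NOT a theorem and is not claimed: that a given ATLAS ROW (a Mumford–Tate type) has divisorial (2,2)/(3,3)-classes on
its members — the atlas certifies `b₂ = d₂`, `b₃ = d₃` for the GENERIC Hodge group of the row (five engines + ENGINE W),
and "member of the row ⟹ `CodimTwoDivisorial A ∧ CodimThreeDivisorial A`" is the row's INPUT-Hg inference (CELL
INFERENCE, RING2-MAP L7.3), model level, never kernel. Nothing here decides `HC_CM`, `HC_AV`, any Weil rung or the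
item stmt-HodgeConjecture-16267. Seat `pub-hodge-ring2-typer1`, gen 9 (class axis files: `Ring2ClassTargets`,
`…Rows`, `…RowsSixSeven*`, `…Atlas`, `…WeilPullback*`, `…SevenfoldSeeds`).

## Rows added to the class-axis table (RING2-MAP §typer1; KIND column: `HC_CM` ABSENT, price NONE)

| class `𝒞` | `HCOnClass 𝒞` | inputs | source |
|---|---|---|---|
| `IsDivisorGenerated` (`B•(A) = D•(A)`) | THEOREM `hcOnClass_isDivisorGenerated` | none | van Geemen §2.4 (tree) |
| `dim ≤ 5 ∧ CodimTwoDivisorial` | THEOREM `hcOnClass_codimTwoDivisorial_of_le_five` | none | MZ99 Introduction + hard Lefschetz (lit p196453) |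
| `dim ≤ 7 ∧ CodimTwoDivisorial ∧ CodimThreeDivisorial` | THEOREM `hcOnClass_lowDegrees_of_le_seven` | none | idem |
| `dim ≤ 7`: `IsDivisorGenerated ↔ CodimTwo ∧ CodimThree` | `isDivisorGenerated_iff_lowDegrees_of_le_seven` | none | idem |

So on the dimension axis (`HCUpToDim 7`, typer1 `Ring2ClassTargetsRowsSixSeven*`) the `B = D` rows cost exactly TWO numerical
certificates per row and NO Weil rung, while the exceptional rows cost the Weil rung of the member's dimension (weil-1 AW1.9):
the window `2 ≤ p ≤ dim A − 2` of `two_le_and_add_two_le_dim_of_exceptional` is where every price of the cell lives.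

References (bib keys): MoonenZarhin1999LowDim (Introduction p. 711, Thm. 0.1); vanGeemen1994HodgeAV (§2.4–2.5);
VoisinHodgeI2002 (Thm. 6.25, Rem. 6.27).
-/

set_option linter.dupNamespace false

noncomputable section

open CategoryTheory
open Literature.AlgebraicTopology.SingularHomology
open Literature.AlgebraicGeometry Literature.AlgebraicGeometry.Motives
open Literature.AlgebraicGeometry.HodgeTheory
open Literature.Geometry.Kaehler
open Literature.Barriers.HodgeConjecture (divisorClassesSpan)

namespace Summit.HodgeConjecture.HodgeConjecture.Ring2.ClassTargets

/-! ## §1 The two numerical hypotheses, as predicates on the variety -/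

/-- `B²(A) ⊆ D²(A) ⊗ ℂ`: every rational `(2,2)`-class on `A` is a polynomial in divisor classes. A definition
(the atlas's "`b₂ = d₂`" stated on the variety, not on the row). [cite: MoonenZarhin1999LowDim, Introduction (p. 711)] -/
def CodimTwoDivisorial (A : AbelianVariety ℂ) : Prop :=
  ∀ c : complexBetti A.X (2 * 2), IsRationalClass c → IsOfHodgeType A.dim A.X (2 * 2) 2 2 c →
    c ∈ divisorClassesSpan A.X A.dim 2

/-- `B³(A) ⊆ D³(A) ⊗ ℂ` ("`b₃ = d₃`" on the variety). A definition. [cite: MoonenZarhin1999LowDim, Introduction (p. 711)] -/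
def CodimThreeDivisorial (A : AbelianVariety ℂ) : Prop :=
  ∀ c : complexBetti A.X (2 * 3), IsRationalClass c → IsOfHodgeType A.dim A.X (2 * 3) 3 3 c →
    c ∈ divisorClassesSpan A.X A.dim 3

/-- `B = D` restricts to the two low degrees (trivially). [folklore] -/
theorem codimTwo_and_codimThree_of_isDivisorGenerated {A : AbelianVariety ℂ} (h : IsDivisorGenerated A) :
    CodimTwoDivisorial A ∧ CodimThreeDivisorial A :=
  ⟨fun c hc hpp ↦ h 2 c hc hpp, fun c hc hpp ↦ h 3 c hc hpp⟩

/-- **For `dim A ≤ 7`, `B = D` is EQUIVALENT to the two low-degree conditions** (hard Lefschetz handles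
`p ≥ 4`, Lefschetz (1,1) handles `p ≤ 1`; lit gen 11). [cite: MoonenZarhin1999LowDim, Introduction (p. 711)]
[cite: VoisinHodgeI2002, Thm. 6.25 and Rem. 6.27] -/
theorem isDivisorGenerated_iff_lowDegrees_of_le_seven {A : AbelianVariety ℂ} (hA : A.dim ≤ 7) :
    IsDivisorGenerated A ↔ CodimTwoDivisorial A ∧ CodimThreeDivisorial A :=
  ⟨codimTwo_and_codimThree_of_isDivisorGenerated,
    fun h ↦ isDivisorGenerated_of_dim_le_seven_of_codimTwo_three A hA h.1 h.2⟩

/-- For `dim A ≤ 5` only the codimension-two condition is needed. [cite: MoonenZarhin1999LowDim, Introduction (p. 711) and Thm. 0.1] -/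
theorem isDivisorGenerated_iff_codimTwo_of_le_five {A : AbelianVariety ℂ} (hA : A.dim ≤ 5) :
    IsDivisorGenerated A ↔ CodimTwoDivisorial A :=
  ⟨fun h ↦ (codimTwo_and_codimThree_of_isDivisorGenerated h).1,
    fun h ↦ isDivisorGenerated_of_dim_le_five_of_codimTwo A hA h⟩

/-! ## §2 The class targets, closed UNCONDITIONALLY -/

/-- **`HC` on the class `B = D`** — van Geemen §2.4 in the cell's shape `HCOnClass`; no binder.
[cite: vanGeemen1994HodgeAV, §2.4 (p. 235)] -/
theorem hcOnClass_isDivisorGenerated : HCOnClass IsDivisorGenerated :=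
  fun A hA ↦ hodgeConjectureFor_of_isDivisorGenerated A hA

/-- **`HC` for abelian varieties of dimension `≤ 5` with divisorial `(2,2)`-classes**, unconditionally.
[cite: MoonenZarhin1999LowDim, Introduction (p. 711) and Thm. 0.1] [cite: vanGeemen1994HodgeAV, §2.4 (p. 235)] -/
theorem hcOnClass_codimTwoDivisorial_of_le_five : HCOnClass fun A ↦ A.dim ≤ 5 ∧ CodimTwoDivisorial A :=
  fun A h ↦ hodgeConjectureFor_of_isDivisorGenerated A (isDivisorGenerated_of_dim_le_five_of_codimTwo A h.1 h.2)

/-- **`HC` for abelian varieties of dimension `≤ 7` with divisorial `(2,2)`- and `(3,3)`-classes**,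
unconditionally — the kernel form of the 25 `B = D` rows of the six- and sevenfold atlas: per row, the two certified
degrees are the only hypotheses, and they are hypotheses ON THE MEMBER. [cite: MoonenZarhin1999LowDim, Introduction (p. 711)]
[cite: vanGeemen1994HodgeAV, §2.4 (p. 235)] -/
theorem hcOnClass_lowDegrees_of_le_seven :
    HCOnClass fun A ↦ A.dim ≤ 7 ∧ CodimTwoDivisorial A ∧ CodimThreeDivisorial A :=
  fun A h ↦ hodgeConjectureFor_of_isDivisorGenerated A
    (isDivisorGenerated_of_dim_le_seven_of_codimTwo_three A h.1 h.2.1 h.2.2)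

/-- The same read on the dimension axis: **`HCUpToDim 7` restricted to the low-degree-divisorial varieties holds**;
what remains of `HCUpToDim 7` is exactly the varieties with an exceptional class in degree 2 or 3 (the Weil-carried
rows). [cite: MoonenZarhin1999LowDim, Introduction (p. 711)] -/
theorem hcUpToDim_seven_of_exceptional_rows
    (hexc : HCOnClass fun A ↦ A.dim ≤ 7 ∧ ¬ (CodimTwoDivisorial A ∧ CodimThreeDivisorial A)) : HCUpToDim 7 := by
  intro A hA
  by_cases h : CodimTwoDivisorial A ∧ CodimThreeDivisorial A
  · exact hcOnClass_lowDegrees_of_le_seven A ⟨hA, h⟩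
  · exact hexc A ⟨hA, h⟩

/-- … and for `HCUpToDim 5` the residual is the varieties with an exceptional `(2,2)`-class only.
[cite: MoonenZarhin1999LowDim, Thm. 0.1] -/
theorem hcUpToDim_five_of_exceptional_codimTwo
    (hexc : HCOnClass fun A ↦ A.dim ≤ 5 ∧ ¬ CodimTwoDivisorial A) : HCUpToDim 5 := by
  intro A hA
  by_cases h : CodimTwoDivisorial A
  · exact hcOnClass_codimTwoDivisorial_of_le_five A ⟨hA, h⟩
  · exact hexc A ⟨hA, h⟩

/-! ## §3 The window of exceptional degrees (where every price of the cell lives) -/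

/-- On an abelian variety of dimension `≤ 3` both low-degree conditions hold automatically (no exceptional
degree: `2 ≤ p ≤ dim − 2` is empty or `p = … ` excluded by hard Lefschetz), recovering `B = D` in dimension `≤ 3`
(lit `isDivisorGenerated_of_dim_le_three`) in the two-predicate form. [cite: MoonenZarhin1999LowDim, Introduction (p. 711)] -/
theorem codimTwo_and_codimThree_of_le_three {A : AbelianVariety ℂ} (hA : A.dim ≤ 3) :
    CodimTwoDivisorial A ∧ CodimThreeDivisorial A :=
  codimTwo_and_codimThree_of_isDivisorGenerated (isDivisorGenerated_of_dim_le_three A hA)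

/-- An abelian variety of dimension `≤ 7` OFF the low-degree class carries an exceptional Hodge class in degree
`2` or `3`, and then `4 ≤ dim A` (degree 2) resp. `5 ≤ dim A` (degree 3): the exceptional rows start in dimension 4.
[cite: vanGeemen1994HodgeAV, §2.5 (p. 235)] [cite: MoonenZarhin1999LowDim, Introduction (p. 711)] -/
theorem four_le_dim_of_not_lowDegrees {A : AbelianVariety ℂ}
    (h : ¬ (CodimTwoDivisorial A ∧ CodimThreeDivisorial A)) : 4 ≤ A.dim := by
  by_contra hlt
  exact h (codimTwo_and_codimThree_of_le_three (by omega))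

end Summit.HodgeConjecture.HodgeConjecture.Ring2.ClassTargets

end
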